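import Summits.BirchSwinnertonDyer.Rank1Residual.O5.CongruenceNumberTwistPrime
import HarnessLib

/-!
# O5 pool: BLOCK-TWIN — the involution half of the congruence-block table is a theorem
# (`r(f;X) = r(f ⊗ χ; X′)` whenever the twist exchanges the blocks `X`, `X′`)

HONEST FRAMING (cell `b2b-bsdres`, run/shared/lean/b2b/bsd-rank1-residual/, verbatim in every
file): the goal of the cell is to DELETE the COMBINATION-SHAPED residual classes of the
Birch–Swinnerton-Dyer formula for ALL analytic-rank `≤ 1` elliptic curves over `ℚ` — assembled
STRICTLY from published theorems — so that the rank-`≤ 1` remainder becomes exactly the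
CONSTRUCTION-SHAPED classes, which are TYPED, NOT attempted. This is not "finishing BSD". Lane
CLASS-CLOSURE, team o5 (planner o5-r2 GEN 7, `gen7/TWIN-PROOF.md` Addendum 18:30Z "BLOCK TWIN",
theorem-candidate `CongruenceBlocksTwistAtNine`; records schema `gen7/BLOCKS-SCHEMA.md` (T-F2),
census CONG3-F: exact on 131/131 optimal twin pairs — EVIDENCE, not an input here); prover seat
`b2b-bsdres-x11b3-p5` GEN 12 (cross-cell pool item P5-BT, invited by the o5-r2 lineage).
THEOREMS ONLY (no definition, no named fact, no `sorry`); nothing booked; no RESIDUAL-MAP mark /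
label / count moved; the O5 conjecture nodes (`CongruenceNumberTwin` — already a theorem,
`CongruenceNumberTwistPrime` —, R-TW `CongruenceNumberTwistJumpAtNine`, R-FLAT
`CongruenceDefectFlatTwinAtNine`, E-O5-CONG `CongruenceDefectLawAtNine`) are UNTOUCHED and NOT
discharged; NO congruence block (`B0`, `B1`, `ω̃BT`, `ω̃St`, `SC` of the planner's table) is DEFINED
here — the blocks enter as ARBITRARY `ℂ`-subspaces `X`, `X′` exchanged by the twist.

## Setting

`p` a prime with `p² ∣ N`, `χ` the primitive quadratic Dirichlet character mod `p`,
`R = charTwist N dvd_rfl hpN hχ : S_k(Γ₀(N)) → S_k(Γ₀(N))` the twist `∑ aₙqⁿ ↦ ∑ χ(n) aₙ qⁿ` AT THE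
SAME LEVEL (Shimura 1971 Prop. 3.64; the tree's `charTwist`, and o5's `O5/CharTwistPrimeLevel.lean`,
`O5/CharTwistPrimeIsometry.lean`: `R` is `ℂ`-linear, preserves `S = S_k(Γ₀(N); ℤ)`
(`integralCuspForms0`), is an involution on `p`-depleted forms (`R (R f) = f` when `aₙ(f) = 0` for
`p ∣ n`) and is a Petersson isometry there). For `f ∈ S_k(Γ₀(N))` and a `ℂ`-subspace `X` put

* the **block lattice** `S ⊓ (ℂf ⊔ X)` (integral forms in `ℂf ⊕ X`), and
* the **block sublattice** `ℤf ⊔ (S ⊓ X)`,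

both spelled out in every statement (no definition is introduced). When `X` is a sum of old
spaces orthogonal to a newform `f` with integer coefficients (the planner's blocks), the order of
the quotient `(S ⊓ (ℂf ⊔ X)) / (ℤf ⊔ (S ⊓ X))` is the BLOCK CONGRUENCE NUMBER `r(f;X)` of
o5-r2's TWIN-PROOF Addendum (= the largest `c` such that `f ≡ g (mod c S)` for some `g ∈ S ∩ X`;
Agashe–Ribet–Stein 2012 §2.1 (i)/(ii) restricted to `ℚf ⊕ X`); for `X = f^⊥` it is the ARS
congruence number `congruenceNumber f` (`natCard_blockQuotient_ker_eq_congruenceNumber` below).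

## What is proved (EVERY pair of `ℂ`-subspaces `X`, `X′` with `R(X) ⊆ X′`, `R(X′) ⊆ X`; `f` `p`-depleted)

* §1 transport: `R` maps the block lattice / sublattice of `(f, X)` into those of `(Rf, X′)`, and
  `x − R(Rx) ∈ S ⊓ X` on the block lattice of `(f, X)` (the one new ingredient over TWIN).
* §2 **`natCard_blockQuotient_charTwist`** (the planner's CLAIM = T-F2's involution half):
  `#((S ⊓ (ℂf ⊔ X)) / (ℤf ⊔ (S ⊓ X))) = #((S ⊓ (ℂRf ⊔ X′)) / (ℤRf ⊔ (S ⊓ X′)))` (`Nat.card`;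
  `R` induces a BIJECTION of the quotients, as in `PrimeTwist.congruenceNumber_charTwist`); NO
  orthogonality / Hecke-stability / rationality of `X` is needed (they only give the quotient its
  name and finiteness); junk-safe. **`blockCongruence_charTwist`**: ARS (i)-style transport of a
  congruence `f ≡ g (mod cS)`, `g ∈ S ∩ (ℂf ⊔ X)`, `g ⊥ f`, to `(Rf, Rg, X′)`.
* §3 `X = f^⊥ = ker ⟨f, ·⟩`, `X′ = (Rf)^⊥` satisfy the hypotheses (orthogonality transport) and the
  block quotient of `(f, f^⊥)` IS the ARS quotient: §2 contains o5's TWIN as the coarsest block.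
* §4 spans: `R(T) ⊆ X′ ⟹ R(span T) ⊆ X′` — how concrete blocks (spans of degeneracy images `ι_d g`;
  commutation `R ∘ ι_d = χ(d) ι_d ∘ R` in the sibling `O5/CongruenceBlockTwistDegeneracy.lean`) are fed.

Not claimed, not defined: the block DECOMPOSITION of `S₂(Γ₀(9M))` by `3`-adic inertial type, the
identification of the planner's five blocks with Hecke-stable rational sums of old spaces, exact
levels of Steinberg twists, `SC`-stability. presearch (P5-BT, 2026-08-21): corpus `lit search
--hybrid "congruence module quadratic twist old space"`, `lit vsearch "congruence number of a
newform is invariant under twisting by a quadratic character"`, galaxy `"congruence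
number|congruence module|twisting operator"` — hits = congruence modules of Hecke algebras
(Hida 2000 pp. 340/372; Diamond–Ribet in Cornell–Silverman–Stevens 1997), none about twisting:
no statement of block / twist invariance found (o5-r2's 'none found' re-confirmed); nearest print
[AgasheRibetStein2012] §2.1, [Shimura1971] Prop. 3.64, [AtkinLi1978] §3. New statement ⇒ `Summits/`.
References: [AgasheRibetStein2012] §2.1; [Shimura1971] Prop. 3.64; cell files
`HOME/b2b-bsdres-o5-r2/gen7/{TWIN-PROOF.md, BLOCKS-SCHEMA.md}`, `gen8/O5-GEN8.md` §G8-3.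
-/

noncomputable section

open scoped MatrixGroups ModularForm

open CongruenceSubgroup Literature.NumberTheory.EllipticCurves.ModularForms

namespace Summit.BirchSwinnertonDyer.Rank1Residual.O5

namespace PrimeTwist

variable {N p : ℕ} [NeZero N] [hp : Fact p.Prime] {k : ℤ} (hpN : p ^ 2 ∣ N)
  {χ : DirichletCharacter ℂ p} (hχ : χ.IsQuadratic)

/-! ### §1 Transport of the block lattice and sublattice under the twist -/

/-- `R 0 = 0` (the twist is `ℂ`-linear). [cite: Shimura1971, Prop. 3.64] -/
theorem charTwist_zero_form (hprim : χ.IsPrimitive) :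
    charTwist N dvd_rfl hpN hχ (0 : CuspForm (Gamma0 N) k) = 0 := by
  simpa using charTwist_smul hpN hχ hprim (0 : ℂ) (0 : CuspForm (Gamma0 N) k)

/-- `R` maps `ℂf ⊔ X` into `ℂ(Rf) ⊔ X′` as soon as `R(X) ⊆ X′` (`R` is `ℂ`-linear).
[cite: Shimura1971, Prop. 3.64] -/
theorem charTwist_mem_span_sup (hprim : χ.IsPrimitive) (f : CuspForm (Gamma0 N) k)
    {X X' : Submodule ℂ (CuspForm (Gamma0 N) k)}
    (hX : ∀ x ∈ X, charTwist N dvd_rfl hpN hχ x ∈ X') {x : CuspForm (Gamma0 N) k}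
    (hx : x ∈ (ℂ ∙ f) ⊔ X) :
    charTwist N dvd_rfl hpN hχ x ∈ (ℂ ∙ charTwist N dvd_rfl hpN hχ f) ⊔ X' := by
  obtain ⟨a, ha, b, hb, rfl⟩ := Submodule.mem_sup.mp hx
  obtain ⟨c, rfl⟩ := Submodule.mem_span_singleton.mp ha
  rw [charTwist_add hpN hχ hprim, charTwist_smul hpN hχ hprim]
  exact Submodule.add_mem _
    (Submodule.mem_sup_left (Submodule.mem_span_singleton.mpr ⟨c, rfl⟩))
    (Submodule.mem_sup_right (hX b hb))

/-- **`R` maps the block lattice of `(f, X)` into the block lattice of `(Rf, X′)`**: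
`x ∈ S ⊓ (ℂf ⊔ X) ⟹ R x ∈ S ⊓ (ℂRf ⊔ X′)` (`S = S_k(Γ₀(N); ℤ)`; `R(X) ⊆ X′`).
[cite: AgasheRibetStein2012, §2.1] [cite: Shimura1971, Prop. 3.64] -/
theorem charTwist_mem_blockLattice (hprim : χ.IsPrimitive) (f : CuspForm (Gamma0 N) k)
    {X X' : Submodule ℂ (CuspForm (Gamma0 N) k)}
    (hX : ∀ x ∈ X, charTwist N dvd_rfl hpN hχ x ∈ X') {x : CuspForm (Gamma0 N) k}
    (hx : x ∈ integralCuspForms0 N k ⊓ ((ℂ ∙ f) ⊔ X).restrictScalars ℤ) :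
    charTwist N dvd_rfl hpN hχ x ∈ integralCuspForms0 N k ⊓
      ((ℂ ∙ charTwist N dvd_rfl hpN hχ f) ⊔ X').restrictScalars ℤ := by
  rw [Submodule.mem_inf, Submodule.restrictScalars_mem] at hx ⊢
  exact ⟨charTwist_mem_integralCuspForms0 hpN hχ hprim hx.1,
    charTwist_mem_span_sup hpN hχ hprim f hX hx.2⟩

/-- **`R` maps the block sublattice of `(f, X)` into the block sublattice of `(Rf, X′)`**:
`x ∈ ℤf ⊔ (S ⊓ X) ⟹ R x ∈ ℤRf ⊔ (S ⊓ X′)` (`R(X) ⊆ X′`).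
[cite: AgasheRibetStein2012, §2.1] [cite: Shimura1971, Prop. 3.64] -/
theorem charTwist_mem_blockSublattice (hprim : χ.IsPrimitive) (f : CuspForm (Gamma0 N) k)
    {X X' : Submodule ℂ (CuspForm (Gamma0 N) k)}
    (hX : ∀ x ∈ X, charTwist N dvd_rfl hpN hχ x ∈ X') {x : CuspForm (Gamma0 N) k}
    (hx : x ∈ (ℤ ∙ f) ⊔ (integralCuspForms0 N k ⊓ X.restrictScalars ℤ)) :
    charTwist N dvd_rfl hpN hχ x ∈ (ℤ ∙ charTwist N dvd_rfl hpN hχ f) ⊔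
      (integralCuspForms0 N k ⊓ X'.restrictScalars ℤ) := by
  obtain ⟨a, ha, b, hb, rfl⟩ := Submodule.mem_sup.mp hx
  obtain ⟨z, rfl⟩ := Submodule.mem_span_singleton.mp ha
  rw [Submodule.mem_inf, Submodule.restrictScalars_mem] at hb
  rw [charTwist_add hpN hχ hprim, charTwist_zsmul hpN hχ hprim]
  refine Submodule.add_mem _
    (Submodule.mem_sup_left (Submodule.mem_span_singleton.mpr ⟨z, rfl⟩))
    (Submodule.mem_sup_right ?_)
  rw [Submodule.mem_inf, Submodule.restrictScalars_mem]
  exact ⟨charTwist_mem_integralCuspForms0 hpN hχ hprim hb.1, hX b hb.2⟩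

/-- **`x − R(Rx) ∈ S ⊓ X` for `x` in the block lattice of `(f, X)`**, when `f` is `p`-depleted,
`R(X) ⊆ X′` and `R(X′) ⊆ X`: writing `x = c f + ξ`, `ξ ∈ X`, one has `R(Rx) = c f + R(Rξ)`
(`R(Rf) = f`) and `R(Rξ) ∈ R(X′) ⊆ X`. This is the one new ingredient over the coarse TWIN.
[cite: AgasheRibetStein2012, §2.1] [cite: Shimura1971, Prop. 3.64] -/
theorem sub_charTwist_charTwist_mem_blockInf (hprim : χ.IsPrimitive) {f : CuspForm (Gamma0 N) k}
    (hf : ∀ n, p ∣ n → cuspCoeff f n = 0) {X X' : Submodule ℂ (CuspForm (Gamma0 N) k)}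
    (hX : ∀ x ∈ X, charTwist N dvd_rfl hpN hχ x ∈ X')
    (hX' : ∀ x ∈ X', charTwist N dvd_rfl hpN hχ x ∈ X) {x : CuspForm (Gamma0 N) k}
    (hx : x ∈ integralCuspForms0 N k ⊓ ((ℂ ∙ f) ⊔ X).restrictScalars ℤ) :
    x - charTwist N dvd_rfl hpN hχ (charTwist N dvd_rfl hpN hχ x) ∈
      integralCuspForms0 N k ⊓ X.restrictScalars ℤ := by
  rw [Submodule.mem_inf, Submodule.restrictScalars_mem] at hx ⊢
  obtain ⟨hxS, hxV⟩ := hx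
  refine ⟨Submodule.sub_mem _ hxS (charTwist_mem_integralCuspForms0 hpN hχ hprim
    (charTwist_mem_integralCuspForms0 hpN hχ hprim hxS)), ?_⟩
  obtain ⟨a, ha, b, hb, rfl⟩ := Submodule.mem_sup.mp hxV
  obtain ⟨c, rfl⟩ := Submodule.mem_span_singleton.mp ha
  rw [charTwist_add hpN hχ hprim, charTwist_smul hpN hχ hprim, charTwist_add hpN hχ hprim,
    charTwist_smul hpN hχ hprim, charTwist_charTwist hpN hχ hprim hf, add_sub_add_left_eq_sub]
  exact Submodule.sub_mem _ hb (hX' _ (hX b hb))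

/-! ### §2 BLOCK-TWIN: the block quotients of `(f, X)` and `(Rf, X′)` are in bijection -/

/-- **BLOCK-TWIN (o5-r2 GEN 7, TWIN-PROOF Addendum CLAIM; BLOCKS-SCHEMA T-F2).** Let `p` be a
prime with `p² ∣ N`, `χ` the primitive quadratic character mod `p`, `R` the twist by `χ` on
`S_k(Γ₀(N))`, `f` a `p`-depleted form (`aₙ(f) = 0` for `p ∣ n`; every newform of level `N` is),
and `X`, `X′` ANY two `ℂ`-subspaces of `S_k(Γ₀(N))` with `R(X) ⊆ X′` and `R(X′) ⊆ X`. Then the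
block quotients have the same order:
`#((S ⊓ (ℂf ⊔ X)) / (ℤf ⊔ (S ⊓ X))) = #((S ⊓ (ℂRf ⊔ X′)) / (ℤRf ⊔ (S ⊓ X′)))`
(`S = S_k(Γ₀(N); ℤ)`, `Nat.card`, junk-safe). When `X ⊥ f` is a rational Hecke-stable sum of old
spaces this is `r(f;X) = r(f ⊗ χ; X′)`; with `X ↔ X′` the pairs `B0 ↔ ω̃BT`, `B1 ↔ ω̃St`,
`SC ⊖ f ↔ SC ⊖ f^χ` (and all unions) of the planner's table at `9 ∥ N` it is T-F2 — the block
hypotheses themselves are the reader's. Proof: `R` induces a map of quotients (§1), injective and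
surjective because `x − R(Rx)` lies in `S ⊓ X` (resp. `S ⊓ X′`) and `R(Rf) = f`.
[cite: AgasheRibetStein2012, §2.1] [cite: Shimura1971, Prop. 3.64] -/
theorem natCard_blockQuotient_charTwist (hprim : χ.IsPrimitive) {f : CuspForm (Gamma0 N) k}
    (hf : ∀ n, p ∣ n → cuspCoeff f n = 0) {X X' : Submodule ℂ (CuspForm (Gamma0 N) k)}
    (hX : ∀ x ∈ X, charTwist N dvd_rfl hpN hχ x ∈ X')
    (hX' : ∀ x ∈ X', charTwist N dvd_rfl hpN hχ x ∈ X) :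
    Nat.card (↥(integralCuspForms0 N k ⊓ ((ℂ ∙ f) ⊔ X).restrictScalars ℤ) ⧸
        ((ℤ ∙ f) ⊔ (integralCuspForms0 N k ⊓ X.restrictScalars ℤ)).comap
          (integralCuspForms0 N k ⊓ ((ℂ ∙ f) ⊔ X).restrictScalars ℤ).subtype) =
      Nat.card (↥(integralCuspForms0 N k ⊓
            ((ℂ ∙ charTwist N dvd_rfl hpN hχ f) ⊔ X').restrictScalars ℤ) ⧸
        ((ℤ ∙ charTwist N dvd_rfl hpN hχ f) ⊔
            (integralCuspForms0 N k ⊓ X'.restrictScalars ℤ)).comap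
          (integralCuspForms0 N k ⊓
            ((ℂ ∙ charTwist N dvd_rfl hpN hχ f) ⊔ X').restrictScalars ℤ).subtype) := by
  set g := charTwist N dvd_rfl hpN hχ f with hg
  have hRg : ∀ n, p ∣ n → cuspCoeff g n = 0 :=
    fun n hn ↦ cuspCoeff_charTwist_eq_zero_of_dvd hpN hχ hprim f hn
  have hgg : charTwist N dvd_rfl hpN hχ g = f := charTwist_charTwist hpN hχ hprim hf
  set A : Submodule ℤ (CuspForm (Gamma0 N) k) :=
    integralCuspForms0 N k ⊓ ((ℂ ∙ f) ⊔ X).restrictScalars ℤ with hA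
  set A' : Submodule ℤ (CuspForm (Gamma0 N) k) :=
    integralCuspForms0 N k ⊓ ((ℂ ∙ g) ⊔ X').restrictScalars ℤ with hA'
  set B : Submodule ℤ (CuspForm (Gamma0 N) k) :=
    (ℤ ∙ f) ⊔ (integralCuspForms0 N k ⊓ X.restrictScalars ℤ) with hB
  set B' : Submodule ℤ (CuspForm (Gamma0 N) k) :=
    (ℤ ∙ g) ⊔ (integralCuspForms0 N k ⊓ X'.restrictScalars ℤ) with hB'
  -- the twist as a `ℤ`-linear map of block lattices
  let φ : A →ₗ[ℤ] A' :=
    { toFun := fun x ↦ ⟨charTwist N dvd_rfl hpN hχ x,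
        charTwist_mem_blockLattice hpN hχ hprim f hX x.2⟩
      map_add' := fun x y ↦ Subtype.ext (charTwist_add hpN hχ hprim (x : CuspForm (Gamma0 N) k) y)
      map_smul' := fun z x ↦
        Subtype.ext (charTwist_zsmul hpN hχ hprim z (x : CuspForm (Gamma0 N) k)) }
  have hφ : ∀ x : A, ((φ x : A') : CuspForm (Gamma0 N) k) = charTwist N dvd_rfl hpN hχ x :=
    fun _ ↦ rfl
  have hle : B.comap A.subtype ≤ (B'.comap A'.subtype).comap φ := by
    intro x hx
    rw [Submodule.mem_comap, Submodule.mem_comap, Submodule.subtype_apply, hφ]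
    rw [Submodule.mem_comap, Submodule.subtype_apply] at hx
    exact charTwist_mem_blockSublattice hpN hχ hprim f hX hx
  let ψ : (A ⧸ B.comap A.subtype) →ₗ[ℤ] (A' ⧸ B'.comap A'.subtype) :=
    (B.comap A.subtype).mapQ (B'.comap A'.subtype) φ hle
  have hψ : ∀ x : A, ψ (Submodule.Quotient.mk x) = Submodule.Quotient.mk (φ x) := fun _ ↦ rfl
  have hinj : Function.Injective ψ := by
    rw [← LinearMap.ker_eq_bot, LinearMap.ker_eq_bot']
    intro q hq
    obtain ⟨x, rfl⟩ := Submodule.Quotient.mk_surjective _ q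
    rw [hψ, Submodule.Quotient.mk_eq_zero, Submodule.mem_comap, Submodule.subtype_apply, hφ] at hq
    rw [Submodule.Quotient.mk_eq_zero, Submodule.mem_comap, Submodule.subtype_apply]
    -- `R x ∈ B'` gives `R (R x) ∈ B` (transport back, `R(Rf) = f`), and `x − R(Rx) ∈ S ⊓ X ≤ B`
    have h2 := charTwist_mem_blockSublattice hpN hχ hprim g hX' hq
    rw [hgg] at h2
    have h3 : (x : CuspForm (Gamma0 N) k) -
        charTwist N dvd_rfl hpN hχ (charTwist N dvd_rfl hpN hχ x) ∈ B :=
      Submodule.mem_sup_right (sub_charTwist_charTwist_mem_blockInf hpN hχ hprim hf hX hX' x.2)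
    simpa using Submodule.add_mem _ h3 h2
  have hsurj : Function.Surjective ψ := by
    intro q
    obtain ⟨y, rfl⟩ := Submodule.Quotient.mk_surjective _ q
    have hyA : charTwist N dvd_rfl hpN hχ (y : CuspForm (Gamma0 N) k) ∈ A := by
      have h1 := charTwist_mem_blockLattice hpN hχ hprim g hX' y.2
      rwa [hgg] at h1
    refine ⟨Submodule.Quotient.mk ⟨_, hyA⟩, ?_⟩
    rw [hψ, Submodule.Quotient.eq, Submodule.mem_comap, Submodule.subtype_apply]
    -- `y − R(Ry) ∈ S ⊓ X′ ≤ B'`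
    have h' := sub_charTwist_charTwist_mem_blockInf hpN hχ hprim hRg hX' hX y.2
    have h'' : -((y : CuspForm (Gamma0 N) k) -
        charTwist N dvd_rfl hpN hχ (charTwist N dvd_rfl hpN hχ y)) ∈ B' :=
      Submodule.neg_mem _ (Submodule.mem_sup_right h')
    simpa [hφ, neg_sub] using h''
  exact Nat.card_congr (Equiv.ofBijective ψ ⟨hinj, hsurj⟩)

/-- **Admissible-modulus transport (ARS (i)-style form of BLOCK-TWIN).** With `R`, `f`
(`p`-depleted), `X`, `X′` (`R(X) ⊆ X′`) as above: if `g ∈ S`, `g ∈ ℂf ⊔ X`, `⟨f, g⟩ = 0` and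
`f − g = c • h` with `h ∈ S` (a congruence `f ≡ g (mod c S)` inside the block), then `Rg ∈ S`,
`Rg ∈ ℂRf ⊔ X′`, `⟨Rf, Rg⟩ = 0`, `Rh ∈ S` and `Rf − Rg = c • Rh`: the modulus `c` is admissible
for `(Rf, X′)`. (Petersson isometry of the twist on `p`-depleted forms + linearity + integrality.)
[cite: AgasheRibetStein2012, §2.1] [cite: Shimura1971, Prop. 3.64] -/
theorem blockCongruence_charTwist (hprim : χ.IsPrimitive) {f : CuspForm (Gamma0 N) k}
    (hf : ∀ n, p ∣ n → cuspCoeff f n = 0) {X X' : Submodule ℂ (CuspForm (Gamma0 N) k)}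
    (hX : ∀ x ∈ X, charTwist N dvd_rfl hpN hχ x ∈ X') {g h : CuspForm (Gamma0 N) k} {c : ℕ}
    (hg : g ∈ integralCuspForms0 N k) (hgX : g ∈ (ℂ ∙ f) ⊔ X)
    (hfg : peterssonProduct (Gamma0 N) k f g = 0) (hh : h ∈ integralCuspForms0 N k)
    (hc : f - g = c • h) :
    charTwist N dvd_rfl hpN hχ g ∈ integralCuspForms0 N k ∧
      charTwist N dvd_rfl hpN hχ g ∈ (ℂ ∙ charTwist N dvd_rfl hpN hχ f) ⊔ X' ∧
      peterssonProduct (Gamma0 N) k (charTwist N dvd_rfl hpN hχ f)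
          (charTwist N dvd_rfl hpN hχ g) = 0 ∧
      charTwist N dvd_rfl hpN hχ h ∈ integralCuspForms0 N k ∧
      charTwist N dvd_rfl hpN hχ f - charTwist N dvd_rfl hpN hχ g =
        c • charTwist N dvd_rfl hpN hχ h := by
  refine ⟨charTwist_mem_integralCuspForms0 hpN hχ hprim hg,
    charTwist_mem_span_sup hpN hχ hprim f hX hgX,
    peterssonProduct_charTwist_charTwist_eq_zero hpN hχ hprim hf hfg,
    charTwist_mem_integralCuspForms0 hpN hχ hprim hh, ?_⟩
  have e := congrArg (charTwist N dvd_rfl hpN hχ) hc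
  rw [← natCast_zsmul, charTwist_zsmul hpN hχ hprim, natCast_zsmul] at e
  have hsub : charTwist N dvd_rfl hpN hχ (f - g) =
      charTwist N dvd_rfl hpN hχ f - charTwist N dvd_rfl hpN hχ g := by
    rw [sub_eq_add_neg, charTwist_add hpN hχ hprim, ← neg_one_zsmul, charTwist_zsmul hpN hχ hprim,
      neg_one_zsmul, ← sub_eq_add_neg]
  rw [← hsub, e]

/-! ### §3 The coarsest block: `X = f^⊥` recovers the ARS quotient (TWIN is the case `X = f^⊥`) -/

/-- `ℂf ⊔ f^⊥ = S_k(Γ₀(N))`, `f^⊥ = ker ⟨f, ·⟩`: `x = (⟨f,x⟩/⟨f,f⟩) f + (x − (⟨f,x⟩/⟨f,f⟩) f)` for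
`f ≠ 0` (`⟨f, f⟩ > 0`, `peterssonProduct_self_pos`), and `0^⊥ = ⊤`. [cite: DiamondShurman2005, §5.4] -/
theorem span_sup_ker_peterssonProduct_eq_top (f : CuspForm (Gamma0 N) k) :
    (ℂ ∙ f) ⊔ LinearMap.ker (peterssonProductₗ (Gamma0 N) k f) = ⊤ := by
  rw [eq_top_iff]
  intro x _
  by_cases hf : f = 0
  · refine Submodule.mem_sup_right ?_
    rw [LinearMap.mem_ker, peterssonProductₗ_apply, hf]
    exact peterssonProduct_zero_left _ k x
  · have hff : peterssonProduct (Gamma0 N) k f f ≠ 0 := by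
      intro h0
      have hpos := peterssonProduct_self_pos_holds (Gamma0 N : Subgroup (GL (Fin 2) ℝ)) k hf
      have h0' : peterssonProduct (Gamma0 N) k f f = 0 := h0
      rw [h0', Complex.zero_re] at hpos
      exact lt_irrefl _ hpos
    set c : ℂ := peterssonProduct (Gamma0 N) k f x / peterssonProduct (Gamma0 N) k f f with hc
    have hx : x = c • f + (x - c • f) := by abel
    rw [hx]
    refine Submodule.add_mem _
      (Submodule.mem_sup_left (Submodule.mem_span_singleton.mpr ⟨c, rfl⟩))
      (Submodule.mem_sup_right ?_)
    rw [LinearMap.mem_ker, map_sub, map_smul, peterssonProductₗ_apply, peterssonProductₗ_apply,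
      smul_eq_mul, hc, div_mul_cancel₀ _ hff, sub_self]

/-- **The block quotient of `(f, f^⊥)` is the ARS quotient**: with `X = ker ⟨f, ·⟩` the block
lattice is all of `S_k(Γ₀(N); ℤ)` (`ℂf ⊔ f^⊥ = ⊤`) and the block sublattice is `ℤf ⊔ (ℤf)^⊥`
(`integralOrthogonal0 f = S ⊓ f^⊥` by definition), so its order is `congruenceNumber f`
(ARS 2012 §2.1 (ii)). Hence `natCard_blockQuotient_charTwist` with `X = f^⊥`, `X′ = (Rf)^⊥`
(hypotheses: `charTwist_mem_ker_peterssonProductₗ`) is o5's TWIN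
`PrimeTwist.congruenceNumber_charTwist` — the coarsest instance of BLOCK-TWIN.
[cite: AgasheRibetStein2012, §2.1] -/
theorem natCard_blockQuotient_ker_eq_congruenceNumber (f : CuspForm (Gamma0 N) k) :
    Nat.card (↥(integralCuspForms0 N k ⊓
          ((ℂ ∙ f) ⊔ LinearMap.ker (peterssonProductₗ (Gamma0 N) k f)).restrictScalars ℤ) ⧸
        ((ℤ ∙ f) ⊔ (integralCuspForms0 N k ⊓
            (LinearMap.ker (peterssonProductₗ (Gamma0 N) k f)).restrictScalars ℤ)).comap
          (integralCuspForms0 N k ⊓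
            ((ℂ ∙ f) ⊔ LinearMap.ker (peterssonProductₗ (Gamma0 N) k f)).restrictScalars ℤ).subtype) =
      congruenceNumber f := by
  have hA : integralCuspForms0 N k ⊓
      ((ℂ ∙ f) ⊔ LinearMap.ker (peterssonProductₗ (Gamma0 N) k f)).restrictScalars ℤ =
        integralCuspForms0 N k := by
    rw [span_sup_ker_peterssonProduct_eq_top, Submodule.restrictScalars_top, inf_top_eq]
  rw [congruenceNumber_def]
  -- transport along the equality of block lattices (`integralOrthogonal0 f = S ⊓ f^⊥` is `rfl`)
  have key : ∀ {A₁ A₂ : Submodule ℤ (CuspForm (Gamma0 N) k)} (B : Submodule ℤ (CuspForm (Gamma0 N) k)),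
      A₁ = A₂ → Nat.card (↥A₁ ⧸ B.comap A₁.subtype) = Nat.card (↥A₂ ⧸ B.comap A₂.subtype) := by
    intro A₁ A₂ B h
    subst h
    rfl
  exact key ((ℤ ∙ f) ⊔ integralOrthogonal0 f) hA

/-- **Orthogonality transport makes `(f^⊥, (Rf)^⊥)` an exchanged pair**: for `p`-depleted `f`,
`R(f^⊥) ⊆ (Rf)^⊥` (`⟨Rf, Rx⟩ = ⟨f, x⟩`, Petersson isometry of the twist) — and, applied to `Rf`
with `R(Rf) = f`, `R((Rf)^⊥) ⊆ f^⊥`. These are the two hypotheses of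
`natCard_blockQuotient_charTwist` for the coarsest block. [cite: Shimura1971, Prop. 3.64]
[cite: DiamondShurman2005, Prop. 5.5.2(a)] -/
theorem charTwist_mem_ker_peterssonProductₗ (hprim : χ.IsPrimitive) {f : CuspForm (Gamma0 N) k}
    (hf : ∀ n, p ∣ n → cuspCoeff f n = 0) {x : CuspForm (Gamma0 N) k}
    (hx : x ∈ LinearMap.ker (peterssonProductₗ (Gamma0 N) k f)) :
    charTwist N dvd_rfl hpN hχ x ∈
      LinearMap.ker (peterssonProductₗ (Gamma0 N) k (charTwist N dvd_rfl hpN hχ f)) := by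
  rw [LinearMap.mem_ker, peterssonProductₗ_apply] at hx ⊢
  exact peterssonProduct_charTwist_charTwist_eq_zero hpN hχ hprim hf hx

/-- The converse inclusion `R((Rf)^⊥) ⊆ f^⊥` for `p`-depleted `f` (`Rf` is `p`-depleted and
`R(Rf) = f`). [cite: Shimura1971, Prop. 3.64] -/
theorem charTwist_mem_ker_peterssonProductₗ' (hprim : χ.IsPrimitive) {f : CuspForm (Gamma0 N) k}
    (hf : ∀ n, p ∣ n → cuspCoeff f n = 0) {x : CuspForm (Gamma0 N) k}
    (hx : x ∈ LinearMap.ker (peterssonProductₗ (Gamma0 N) k (charTwist N dvd_rfl hpN hχ f))) :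
    charTwist N dvd_rfl hpN hχ x ∈ LinearMap.ker (peterssonProductₗ (Gamma0 N) k f) := by
  have h := charTwist_mem_ker_peterssonProductₗ hpN hχ hprim
    (fun n hn ↦ cuspCoeff_charTwist_eq_zero_of_dvd hpN hχ hprim f hn) hx
  rwa [charTwist_charTwist hpN hχ hprim hf] at h

/-- **TWIN as the coarsest block of BLOCK-TWIN**: for `p`-depleted `f` the ARS quotients of `f`
and `Rf` have the same order, derived here from `natCard_blockQuotient_charTwist` with
`X = f^⊥`, `X′ = (Rf)^⊥` and `natCard_blockQuotient_ker_eq_congruenceNumber` — a consistency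
check against o5's `PrimeTwist.congruenceNumber_charTwist` (same statement, independent route
through the block theorem), stated for the pair of kernels. [cite: AgasheRibetStein2012, §2.1] -/
theorem natCard_blockQuotient_ker_charTwist (hprim : χ.IsPrimitive) {f : CuspForm (Gamma0 N) k}
    (hf : ∀ n, p ∣ n → cuspCoeff f n = 0) :
    Nat.card (↥(integralCuspForms0 N k ⊓
          ((ℂ ∙ f) ⊔ LinearMap.ker (peterssonProductₗ (Gamma0 N) k f)).restrictScalars ℤ) ⧸
        ((ℤ ∙ f) ⊔ (integralCuspForms0 N k ⊓
            (LinearMap.ker (peterssonProductₗ (Gamma0 N) k f)).restrictScalars ℤ)).comap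
          (integralCuspForms0 N k ⊓
            ((ℂ ∙ f) ⊔ LinearMap.ker (peterssonProductₗ (Gamma0 N) k f)).restrictScalars ℤ).subtype) =
      congruenceNumber (charTwist N dvd_rfl hpN hχ f) := by
  rw [natCard_blockQuotient_charTwist hpN hχ hprim hf
      (X := LinearMap.ker (peterssonProductₗ (Gamma0 N) k f))
      (X' := LinearMap.ker (peterssonProductₗ (Gamma0 N) k (charTwist N dvd_rfl hpN hχ f)))
      (fun x hx ↦ charTwist_mem_ker_peterssonProductₗ hpN hχ hprim hf hx)
      (fun x hx ↦ charTwist_mem_ker_peterssonProductₗ' hpN hχ hprim hf hx),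
    natCard_blockQuotient_ker_eq_congruenceNumber]

/-! ### §4 Feeding concrete blocks: spans -/

/-- **Spans**: if `R(T) ⊆ X′` then `R(span_ℂ T) ⊆ X′` (`R` is `ℂ`-linear). With `T` a family of
degeneracy images `ι_d g` and the commutation `R(ι_d g) = χ(d) ι_d(g ⊗ χ)` of the sibling file
`O5/CongruenceBlockTwistDegeneracy.lean`, this is how the planner's blocks (spans of such images)
are fed to `natCard_blockQuotient_charTwist`. [cite: Shimura1971, Prop. 3.64] -/
theorem charTwist_mem_of_mem_span (hprim : χ.IsPrimitive) {T : Set (CuspForm (Gamma0 N) k)}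
    {X' : Submodule ℂ (CuspForm (Gamma0 N) k)}
    (hT : ∀ t ∈ T, charTwist N dvd_rfl hpN hχ t ∈ X') {x : CuspForm (Gamma0 N) k}
    (hx : x ∈ Submodule.span ℂ T) : charTwist N dvd_rfl hpN hχ x ∈ X' := by
  induction hx using Submodule.span_induction with
  | mem t ht => exact hT t ht
  | zero =>
    rw [charTwist_zero_form hpN hχ hprim]
    exact Submodule.zero_mem _
  | add x y _ _ hx hy =>
    rw [charTwist_add hpN hχ hprim]
    exact Submodule.add_mem _ hx hy
  | smul c x _ hx =>
    rw [charTwist_smul hpN hχ hprim]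
    exact Submodule.smul_mem _ c hx

end PrimeTwist

end Summit.BirchSwinnertonDyer.Rank1Residual.O5
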